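import Summits.BirchSwinnertonDyer.BirchSwinnertonDyer.Theorems.ManinLocalTwoThreeStevensIntegralityCES
import Summits.BirchSwinnertonDyer.BirchSwinnertonDyer.Theses.ByReductionTypeAtTwo
import HarnessLib

set_option autoImplicit false
-- the sub-problem namespace `Summit.BirchSwinnertonDyer.BirchSwinnertonDyer` duplicates a component by design (D-0017)
set_option linter.dupNamespace false

/-!
# Route ByReductionTypeAtTwo, aside item `AsideStevensOptimalGamma1AtTwo` (stmt-BirchSwinnertonDyer-23771), closed by name

The item is VERBATIM the Literature named fact `exists_optimal_gamma1ParametrizationData` — existence of Stevens' `X₁(N)`-optimal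
parametrisation datum for the isogeny class of a modular elliptic curve [Stevens1989, §2] [ConradEdixhovenStein2003, §6.1] («CES» in cell
bsd-f2-manin's bookkeeping).  That fact is a tree theorem: `ManinLocalTwoThree.StevensIntegrality.exists_optimal_gamma1ParametrizationData_holds`
(`Theorems/ManinLocalTwoThreeStevensIntegralityCES.lean`: the Stevens datum on the short model with a rational `Γ₁(N)`-presentation, its
global minimal model, and the integrality `u ∈ ℤ` of the lattice multiplier).  This file closes the aside item BY NAME through the
route's declaration.  The proof does NOT pass through the Unbounded Denominators term (it is UDC-free); the close is unconditional as
typed, with the usual caveat that the meaning of the vendored definitions (`Gamma1ParametrizationData`, `IsOptimal`, period lattices)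
is what a statement audit certifies.  BSD is not proved by this; nothing here is an announcement.
[cite: Stevens1989, §2] [cite: ConradEdixhovenStein2003, §6.1 Lemma 6.1.6]
-/

namespace Summit.BirchSwinnertonDyer.BirchSwinnertonDyer.Theorems

/-- **Aside item `AsideStevensOptimalGamma1AtTwo` (stmt-BirchSwinnertonDyer-23771), proved by name**: Stevens' optimal
`X₁(N)`-parametrisation datum exists, by the tree theorem `StevensIntegrality.exists_optimal_gamma1ParametrizationData_holds`.  BSD is
NOT proved by this. [cite: Stevens1989, §2] [cite: ConradEdixhovenStein2003, §6.1 Lemma 6.1.6] -/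
theorem ByReductionTypeAtTwo.AsideStevensOptimalGamma1AtTwo_proof :
    Summit.BirchSwinnertonDyer.BirchSwinnertonDyer.Theses.ByReductionTypeAtTwo.AsideStevensOptimalGamma1AtTwo :=
  ManinLocalTwoThree.StevensIntegrality.exists_optimal_gamma1ParametrizationData_holds

end Summit.BirchSwinnertonDyer.BirchSwinnertonDyer.Theorems
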